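import Mathlib.LinearAlgebra.TensorProduct.Basic
import Mathlib.LinearAlgebra.Finsupp.LinearCombination
import Mathlib.Data.Matrix.Basis
import Mathlib.LinearAlgebra.Matrix.ConjTranspose
import Literature.NumberTheory.Automorphic.ArchimedeanCalculus
import HarnessLib

/-!
# The real quadratic Casimir element of `𝔤𝔩(N, A)` and Nelson's sum of squares

Let `A` be a commutative real Banach `*`-algebra and `𝔤 = 𝔤𝔩(N, A) = Matrix N N A`, viewed as a
REAL Lie algebra (the Lie algebra of the full linear real group `RealMatrixGroup.gl A N`), with
real universal enveloping algebra `U(𝔤)`. Suppose `A` carries a finite **self-dual system of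
units** `(u_s, ε_s)_{s ∈ S}` (`SelfDualUnits`): `ε_s = ±1`, `star u_s = ε_s u_s`, the `u_s`
span `A` over `ℝ`, and the "Frobenius" identity
`∑_s ε_s (x u_s) ⊗ u_s = ∑_s ε_s u_s ⊗ (u_s x)` holds in `A ⊗_ℝ A` for all `x ∈ A` (i.e.
`∑_s ε_s u_s ⊗ u_s` is the Casimir tensor of a trace form; for `A = ℝ^{r₁} × ℂ^{r₂}` take the
units `e_w` (`w` real), `e_w, i e_w` (`w` complex) with signs `1, 1, -1`). Then, with
`X_{s,a,b} = u_s E_{ab} ∈ 𝔤`: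

* `casimirU F = ∑_{s,a,b} ε_s X_{s,a,b} X_{s,b,a}` is CENTRAL in `U(𝔤)` (`casimirU_mem_center`;
  for `A = ℝ` this is the classical Casimir `∑ E_{ab} E_{ba}` of `𝔤𝔩ₙ(ℝ)`, for `A = ℂ` the
  Casimir `∑ (E_{ab} E_{ba} - (iE_{ab})(iE_{ba}))` of `𝔤𝔩ₙ(ℂ)` as a real Lie algebra), and it is
  the image of an explicit central word `casimirWord F` (`isCentralWord_casimirWord`);
* **Nelson's sum of squares** over the spanning family `X_{s,a,b}` differs from twice the Casimir
  by a sum of squares of elements of `𝔨 = 𝔲(N, A)`: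
  `2 ∑ X_{s,a,b}² = 2 · casimirU + ∑ Y_{s,a,b}²`, `Y_{s,a,b} = X_{s,a,b} - ε_s X_{s,b,a}`
  skew-hermitian (`two_smul_sum_sq_eq`, `kGen_mem_compactLie`) — the decomposition
  `∑ Xᵢ² = Ω + 2 Ω_𝔨` of the Laplacian of `G = K exp 𝔭` used to show that `K`-finite
  `Z(𝔤)`-finite vectors are `Δ`-finite (Harish-Chandra 1953, §11; Nelson 1959, §8);
* `exists_repr_unitGen`: the `X_{s,a,b}` span `𝔤` over `ℝ`.

Everything is proved; the only definitions are the hypothesis structure `SelfDualUnits`, the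
generators `glGenL`, `genU`, `unitGen`, `kGen`, and the Casimir `casimirU` / `casimirWord`.

## References

* Harish-Chandra, *Representations of a semisimple Lie group on a Banach space. I*, Trans. AMS 75
  (1953), 185–243, §11 (the Casimir operator of `𝔤`) [HarishChandraTAMS1953].
* E. Nelson, *Analytic vectors*, Ann. of Math. 70 (1959), 572–615 (`Δ = ∑ Xᵢ²`) [Nelson1959].
* A. W. Knapp, *Lie Groups Beyond an Introduction*, 2nd ed. (2002), §V.4 (Casimir element)
  [Knapp2002].
-/

-- Mathlib idiom (Mathlib/Algebra/Lie/OfAssociative.lean); needed to mention Lie subalgebras of matrix algebras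
attribute [local instance 100] LieRing.ofAssociativeRing

open scoped Matrix TensorProduct
open UniversalEnvelopingAlgebra

noncomputable section

namespace Literature.NumberTheory.Automorphic

variable {A : Type*} [NormedCommRing A] [NormedAlgebra ℝ A] [NormedAlgebra ℚ A] [CompleteSpace A]
  [StarRing A] {N : Type*} [Fintype N] [DecidableEq N] {S : Type*} [Fintype S]

/-! ## Self-dual systems of units -/

variable (A S) in
/-- A **self-dual system of units** of the commutative real `*`-algebra `A`: finitely many
`u_s ∈ A` with signs `ε_s = ±1` such that `star u_s = ε_s u_s`, the `u_s` span `A` over `ℝ`, and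
`∑_s ε_s (x u_s) ⊗ u_s = ∑_s ε_s u_s ⊗ (u_s x)` in `A ⊗_ℝ A` for every `x` (the element
`∑ ε_s u_s ⊗ u_s` commutes with `A`; equivalently `(u_s)` and `(ε_s u_s)` are dual bases for a
trace form). Example: `A = ℝ^{r₁} × ℂ^{r₂}` with the units `e_w`, `e_w'`, `i e_w'`.
Knapp 2002, §V.4 (dual bases and the Casimir element). [folklore] -/
structure SelfDualUnits where
  /-- the units `u_s` -/
  u : S → A
  /-- the signs `ε_s` -/
  ε : S → ℝ
  /-- `ε_s = ±1` -/
  ε_sq : ∀ s, ε s * ε s = 1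
  /-- `star u_s = ε_s u_s` -/
  star_u : ∀ s, star (u s) = ε s • u s
  /-- the `u_s` span `A` over `ℝ` -/
  span_u : Submodule.span ℝ (Set.range u) = ⊤
  /-- the Frobenius identity: `∑ ε_s u_s ⊗ u_s` commutes with `A` -/
  frobenius : ∀ x : A,
    ∑ s, ε s • ((x * u s) ⊗ₜ[ℝ] u s) = ∑ s, ε s • (u s ⊗ₜ[ℝ] (u s * x))

/-! ## Generators of `𝔤𝔩(N, A)` and their brackets -/

variable (A) in
/-- The generator `x ↦ x E_{ab}` of `𝔤 = 𝔤𝔩(N, A)` (the Lie algebra of `RealMatrixGroup.gl A N`,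
which is all of `Matrix N N A`), as a real linear map `A → 𝔤`. [folklore] -/
def glGenL (a b : N) : A →ₗ[ℝ] (RealMatrixGroup.gl A N).lie where
  toFun x := ⟨Matrix.single a b x, trivial⟩
  map_add' x y := Subtype.ext (Matrix.single_add a b x y)
  map_smul' t x := Subtype.ext (Matrix.smul_single t a b x).symm

/-- `glGenL A a b x = x E_{ab}` as a matrix. [folklore] -/
@[simp]
theorem coe_glGenL (a b : N) (x : A) :
    ((glGenL A a b x : (RealMatrixGroup.gl A N).lie) : Matrix N N A) = Matrix.single a b x := rfl

/-- The bracket of two generators: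
`[x E_{cd}, y E_{ab}] = δ_{da} (xy) E_{cb} - δ_{bc} (yx) E_{ad}`. [folklore] -/
theorem bracket_glGenL (c d a b : N) (x y : A) :
    ⁅glGenL A c d x, glGenL A a b y⁆ =
      (if d = a then glGenL A c b (x * y) else 0) - (if b = c then glGenL A a d (y * x) else 0) := by
  apply Subtype.ext
  have h1 : Matrix.single c d x * Matrix.single a b y =
      if d = a then Matrix.single c b (x * y) else 0 := by
    split_ifs with h
    · subst h; simp
    · simp [h, Matrix.single_mul_single_of_ne]
  have h2 : Matrix.single a b y * Matrix.single c d x =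
      if b = c then Matrix.single a d (y * x) else 0 := by
    split_ifs with h
    · subst h; simp
    · simp [h, Matrix.single_mul_single_of_ne]
  calc (((⁅glGenL A c d x, glGenL A a b y⁆ : (RealMatrixGroup.gl A N).lie)) : Matrix N N A)
      = Matrix.single c d x * Matrix.single a b y - Matrix.single a b y * Matrix.single c d x := by
        rw [LieSubalgebra.coe_bracket, Ring.lie_def]; rfl
    _ = (if d = a then Matrix.single c b (x * y) else 0) -
          (if b = c then Matrix.single a d (y * x) else 0) := by rw [h1, h2]
    _ = _ := by split_ifs <;> rfl

/-- Every element of `𝔤𝔩(N, A)` is the sum of its entries times the `E_{ab}`. [folklore] -/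
theorem eq_sum_glGenL (Y : (RealMatrixGroup.gl A N).lie) :
    Y = ∑ a, ∑ b, glGenL A a b ((Y : Matrix N N A) a b) := by
  ext : 1
  simp only [AddSubmonoidClass.coe_finsetSum, coe_glGenL]
  exact Matrix.matrix_eq_sum_single (Y : Matrix N N A)

/-! ## The generators in `U(𝔤)` -/

variable (A N) in
/-- The real universal enveloping algebra `U(𝔤𝔩(N, A))`. [folklore] -/
abbrev glU : Type _ := UniversalEnvelopingAlgebra ℝ (RealMatrixGroup.gl A N).lie

variable (A) in
/-- The generator `x ↦ ι(x E_{ab})` of `U(𝔤)`, a real linear map `A → U(𝔤)`. [folklore] -/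
def genU (a b : N) : A →ₗ[ℝ] glU A N :=
  (ι ℝ : (RealMatrixGroup.gl A N).lie →ₗ⁅ℝ⁆ glU A N).toLinearMap ∘ₗ glGenL A a b

/-- `genU A a b x = ι (x E_{ab})`. [folklore] -/
theorem genU_apply (a b : N) (x : A) : genU A a b x = ι ℝ (glGenL A a b x) := rfl

/-- The commutation relation of two generators in `U(𝔤)`:
`ι(xE_{cd}) ι(yE_{ab}) - ι(yE_{ab}) ι(xE_{cd}) = δ_{da} ι((xy)E_{cb}) - δ_{bc} ι((yx)E_{ad})`.
[folklore] -/
theorem genU_comm (c d a b : N) (x y : A) :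
    genU A c d x * genU A a b y - genU A a b y * genU A c d x =
      (if d = a then genU A c b (x * y) else 0) - (if b = c then genU A a d (y * x) else 0) := by
  simp only [genU_apply]
  rw [← LieRing.of_associative_ring_bracket, ← LieHom.map_lie, bracket_glGenL, map_sub (ι ℝ)]
  congr 1
  · split_ifs
    · rfl
    · exact map_zero (ι ℝ)
  · split_ifs
    · rfl
    · exact map_zero (ι ℝ)

/-- An element of `U(L)` commuting with `ι(L)` is central (`U(L)` is generated by `ι(L)`).
[folklore] -/
theorem mem_center_of_forall_ι_comm {L : Type*} [LieRing L] [LieAlgebra ℝ L]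
    {u : UniversalEnvelopingAlgebra ℝ L} (h : ∀ x : L, ι ℝ x * u = u * ι ℝ x) :
    u ∈ Subalgebra.center ℝ (UniversalEnvelopingAlgebra ℝ L) := by
  rw [Subalgebra.mem_center_iff]
  intro w
  obtain ⟨t, rfl⟩ : ∃ t, mkAlgHom ℝ L t = w := RingCon.mkₐ_surjective _ w
  induction t using TensorAlgebra.induction with
  | algebraMap r => rw [AlgHom.commutes]; exact Algebra.commutes r u
  | ι x => rw [← ι_apply]; exact h x
  | mul a c ha hc => rw [map_mul, mul_assoc, hc, ← mul_assoc, ha, mul_assoc]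
  | add a c ha hc => rw [map_add, add_mul, mul_add, ha, hc]

/-! ## The Casimir element and its centrality -/

/-- The **real quadratic Casimir element** of `𝔤𝔩(N, A)` attached to a self-dual system of
units: `Ω = ∑_s ε_s ∑_{a,b} ι(u_s E_{ab}) ι(u_s E_{ba}) ∈ U(𝔤)`. Knapp 2002, §V.4;
Harish-Chandra 1953, §11. [folklore] -/
def casimirU (F : SelfDualUnits A S) : glU A N :=
  ∑ s, F.ε s • ∑ a : N, ∑ b : N, genU A a b (F.u s) * genU A b a (F.u s)

/-- The Frobenius identity transported through a bilinear map `β : A × A → U(𝔤)`: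
`∑_s ε_s β(x u_s, u_s) = ∑_s ε_s β(u_s, u_s x)`. [folklore] -/
theorem SelfDualUnits.sum_bilin_eq (F : SelfDualUnits A S) (β : A →ₗ[ℝ] A →ₗ[ℝ] glU A N)
    (x : A) : ∑ s, F.ε s • β (x * F.u s) (F.u s) = ∑ s, F.ε s • β (F.u s) (F.u s * x) := by
  have h := congrArg (TensorProduct.lift β) (F.frobenius x)
  simpa [map_sum, map_smul, TensorProduct.lift.tmul] using h

/-- The commutator of a generator `g = ι(x E_{cd})` with one summand
`∑_{a,b} ι(u E_{ab}) ι(u E_{ba})` of the Casimir: four single sums. [folklore] -/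
theorem genU_comm_sum_sq (c d : N) (x u : A) :
    genU A c d x * (∑ a : N, ∑ b : N, genU A a b u * genU A b a u) -
        (∑ a : N, ∑ b : N, genU A a b u * genU A b a u) * genU A c d x =
      (∑ b, genU A c b (x * u) * genU A b d u - ∑ b, genU A c b u * genU A b d (u * x)) +
        (∑ a, genU A a d u * genU A c a (x * u) - ∑ a, genU A a d (u * x) * genU A c a u) := by
  have hcomm : ∀ P Q : glU A N, genU A c d x * (P * Q) - (P * Q) * genU A c d x =
      (genU A c d x * P - P * genU A c d x) * Q + P * (genU A c d x * Q - Q * genU A c d x) :=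
    fun P Q ↦ by noncomm_ring
  rw [Finset.mul_sum, Finset.sum_mul, ← Finset.sum_sub_distrib]
  simp_rw [Finset.mul_sum, Finset.sum_mul, ← Finset.sum_sub_distrib, hcomm, genU_comm,
    sub_mul, mul_sub, ite_mul, mul_ite, zero_mul, mul_zero, Finset.sum_add_distrib,
    Finset.sum_sub_distrib]
  -- evaluate the Kronecker deltas
  have e1 : ∑ a, ∑ b, (if d = a then genU A c b (x * u) * genU A b a u else 0) =
      ∑ b, genU A c b (x * u) * genU A b d u := by
    rw [Finset.sum_comm]
    simp_rw [Finset.sum_ite_eq, Finset.mem_univ, if_true]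
  have e2 : ∑ a, ∑ b, (if b = c then genU A a d (u * x) * genU A b a u else 0) =
      ∑ a, genU A a d (u * x) * genU A c a u := by
    simp_rw [Finset.sum_ite_eq', Finset.mem_univ, if_true]
  have e3 : ∑ a, ∑ b, (if d = b then genU A a b u * genU A c a (x * u) else 0) =
      ∑ a, genU A a d u * genU A c a (x * u) := by
    simp_rw [Finset.sum_ite_eq, Finset.mem_univ, if_true]
  have e4 : ∑ a, ∑ b, (if a = c then genU A a b u * genU A b d (u * x) else 0) =
      ∑ b, genU A c b u * genU A b d (u * x) := by
    rw [Finset.sum_comm]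
    simp_rw [Finset.sum_ite_eq', Finset.mem_univ, if_true]
  rw [e1, e2, e3, e4]
  abel

/-- **The Casimir element commutes with every generator `ι(x E_{cd})`.** The four sums produced
by the commutation relations cancel in pairs by the Frobenius identity. Knapp 2002, §V.4
(centrality of the Casimir element); Harish-Chandra 1953, §11. [folklore] -/
theorem genU_mul_casimirU (F : SelfDualUnits A S) (c d : N) (x : A) :
    genU A c d x * casimirU F = casimirU F * genU A c d x := by
  rw [← sub_eq_zero, casimirU, Finset.mul_sum, Finset.sum_mul, ← Finset.sum_sub_distrib]
  simp_rw [mul_smul_comm, smul_mul_assoc, ← smul_sub, genU_comm_sum_sq, smul_add, smul_sub,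
    Finset.sum_add_distrib, Finset.sum_sub_distrib, Finset.smul_sum]
  rw [Finset.sum_comm (f := fun s b ↦ F.ε s • (genU A c b (x * F.u s) * genU A b d (F.u s))),
    Finset.sum_comm (f := fun s b ↦ F.ε s • (genU A c b (F.u s) * genU A b d (F.u s * x))),
    Finset.sum_comm (f := fun s a ↦ F.ε s • (genU A a d (F.u s) * genU A c a (x * F.u s))),
    Finset.sum_comm (f := fun s a ↦ F.ε s • (genU A a d (F.u s * x) * genU A c a (F.u s)))]
  have h14 : ∀ b, ∑ s, F.ε s • (genU A c b (x * F.u s) * genU A b d (F.u s)) =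
      ∑ s, F.ε s • (genU A c b (F.u s) * genU A b d (F.u s * x)) := fun b ↦
    F.sum_bilin_eq ((LinearMap.mul ℝ (glU A N)).compl₁₂ (genU A c b) (genU A b d)) x
  have h32 : ∀ a, ∑ s, F.ε s • (genU A a d (F.u s) * genU A c a (x * F.u s)) =
      ∑ s, F.ε s • (genU A a d (F.u s * x) * genU A c a (F.u s)) := fun a ↦ by
    have := F.sum_bilin_eq ((LinearMap.mul ℝ (glU A N)).flip.compl₁₂ (genU A c a) (genU A a d)) x
    simpa [LinearMap.compl₁₂_apply, LinearMap.flip_apply, LinearMap.mul_apply'] using this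
  simp_rw [h14, h32, sub_self, add_zero]

/-- **The real Casimir element of `𝔤𝔩(N, A)` is central in `U(𝔤)`.** Knapp 2002, §V.4;
Harish-Chandra 1953, §11. [folklore] -/
theorem casimirU_mem_center (F : SelfDualUnits A S) :
    casimirU (N := N) F ∈ Subalgebra.center ℝ (glU A N) := by
  refine mem_center_of_forall_ι_comm fun Y ↦ ?_
  rw [eq_sum_glGenL Y, map_sum, Finset.sum_mul, Finset.mul_sum]
  refine Finset.sum_congr rfl fun a _ ↦ ?_
  rw [map_sum, Finset.sum_mul, Finset.mul_sum]
  refine Finset.sum_congr rfl fun b _ ↦ ?_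
  exact genU_mul_casimirU F a b _

/-! ## The unit generators, the Casimir word, and Nelson's sum of squares -/

/-- The unit generators `X_{s,a,b} = u_s E_{ab}` of `𝔤𝔩(N, A)` (indexed by `S × N × N`).
[folklore] -/
def unitGen (F : SelfDualUnits A S) (p : S × N × N) : (RealMatrixGroup.gl A N).lie :=
  glGenL A p.2.1 p.2.2 (F.u p.1)

/-- **The unit generators span `𝔤𝔩(N, A)` over `ℝ`**: every `Y ∈ 𝔤` is a real combination
`∑ x_p X_p` (the `u_s` span `A`, the `E_{ab}` span the matrices over `A`). [folklore] -/
theorem exists_repr_unitGen (F : SelfDualUnits A S) (Y : (RealMatrixGroup.gl A N).lie) :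
    ∃ x : S × N × N → ℝ, Y = ∑ p, x p • unitGen F p := by
  classical
  have hcoef : ∀ a b, ∃ c : S → ℝ, ∑ s, c s • F.u s = (Y : Matrix N N A) a b := fun a b ↦ by
    have hmem : (Y : Matrix N N A) a b ∈ Submodule.span ℝ (Set.range F.u) := by
      rw [F.span_u]; trivial
    exact (Submodule.mem_span_range_iff_exists_fun (R := ℝ)).mp hmem
  choose c hc using hcoef
  refine ⟨fun p ↦ c p.2.1 p.2.2 p.1, ?_⟩
  symm
  calc ∑ p : S × N × N, c p.2.1 p.2.2 p.1 • unitGen F p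
      = ∑ a, ∑ b, ∑ s, c a b s • glGenL A a b (F.u s) := by
        rw [Fintype.sum_prod_type, Finset.sum_comm, Fintype.sum_prod_type]
        rfl
    _ = ∑ a, ∑ b, glGenL A a b (∑ s, c a b s • F.u s) := by simp only [map_sum, map_smul]
    _ = ∑ a, ∑ b, glGenL A a b ((Y : Matrix N N A) a b) := by simp only [hc]
    _ = Y := (eq_sum_glGenL Y).symm

/-- The **Casimir word**: the non-commutative polynomial
`∑_{s,a,b} ε_s X_{s,a,b} X_{s,b,a}` in the generators of `𝔤`, whose image in `U(𝔤)` is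
`casimirU F`. [folklore] -/
def casimirWord (F : SelfDualUnits A S) : FreeAlgebra ℝ (RealMatrixGroup.gl A N).lie :=
  ∑ p : S × N × N, F.ε p.1 •
    (FreeAlgebra.ι ℝ (unitGen F p) * FreeAlgebra.ι ℝ (unitGen F (p.1, p.2.2, p.2.1)))

/-- The image of the Casimir word in `U(𝔤)` is the Casimir element. [folklore] -/
theorem freeToEnveloping_casimirWord (F : SelfDualUnits A S) :
    freeToEnveloping (RealMatrixGroup.gl A N) (casimirWord F) = casimirU F := by
  simp only [casimirWord, map_sum, map_smul, map_mul, freeToEnveloping_ι, casimirU,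
    Fintype.sum_prod_type, Finset.smul_sum, unitGen, genU_apply]

/-- **The Casimir word is a central word** (`IsCentralWord` of `ArchimedeanCalculus`), so it acts
on smooth functions inside their `Z(𝔤)`-orbit spans. [folklore] -/
theorem isCentralWord_casimirWord (F : SelfDualUnits A S) :
    IsCentralWord (casimirWord (N := N) F) := by
  rw [IsCentralWord, freeToEnveloping_casimirWord]
  exact casimirU_mem_center F

/-- The `𝔨`-elements `Y_{s,a,b} = X_{s,a,b} - ε_s X_{s,b,a} = u_s (E_{ab} - ε_s E_{ba})`.
[folklore] -/
def kGen (F : SelfDualUnits A S) (p : S × N × N) : (RealMatrixGroup.gl A N).lie :=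
  unitGen F p - F.ε p.1 • unitGen F (p.1, p.2.2, p.2.1)

/-- **`Y_{s,a,b}` is skew-hermitian** (`star u_s = ε_s u_s`, `ε_s² = 1`), i.e. lies in the
compact Lie algebra `𝔨 = 𝔲(N, A)` of `RealMatrixGroup.gl A N`. [folklore] -/
theorem kGen_mem_compactLie [StarModule ℝ A] (F : SelfDualUnits A S) (p : S × N × N) :
    ((kGen F p : (RealMatrixGroup.gl A N).lie) : Matrix N N A) ∈
      (RealMatrixGroup.gl A N).compactLie := by
  rw [RealMatrixGroup.mem_compactLie_iff]
  refine ⟨trivial, ?_⟩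
  obtain ⟨s, a, b⟩ := p
  have hcoe : ((kGen F (s, a, b) : (RealMatrixGroup.gl A N).lie) : Matrix N N A) =
      Matrix.single a b (F.u s) - F.ε s • Matrix.single b a (F.u s) := rfl
  rw [hcoe, Matrix.star_eq_conjTranspose, Matrix.conjTranspose_sub, Matrix.conjTranspose_smul,
    Matrix.conjTranspose_single, Matrix.conjTranspose_single, F.star_u, star_trivial,
    ← Matrix.smul_single, ← Matrix.smul_single, smul_smul, F.ε_sq, one_smul, neg_sub]

/-- In `U(𝔤)`, `ι(Y_{s,a,b}) = ι(X_{s,a,b}) - ε_s ι(X_{s,b,a})`. [folklore] -/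
theorem ι_kGen (F : SelfDualUnits A S) (p : S × N × N) :
    ι ℝ (kGen F p) = genU A p.2.1 p.2.2 (F.u p.1) - F.ε p.1 • genU A p.2.2 p.2.1 (F.u p.1) := by
  change (ι ℝ : (RealMatrixGroup.gl A N).lie →ₗ⁅ℝ⁆ glU A N).toLinearMap
    (unitGen F p - F.ε p.1 • unitGen F (p.1, p.2.2, p.2.1)) = _
  rw [LinearMap.map_sub, LinearMap.map_smul]
  rfl

/-- The sum-of-squares identity in the generators `ι(u_s E_{ab})`:
`2 ∑_{s,a,b} ι(u_sE_{ab})² = 2 Ω + ∑_{s,a,b} (ι(u_sE_{ab}) - ε_s ι(u_sE_{ba}))²` (per `s`, expand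
and reindex `(a, b) ↔ (b, a)`, using `ε_s² = 1`). [folklore] -/
theorem two_smul_sum_sq_genU_eq (F : SelfDualUnits A S) :
    (2 : ℝ) • ∑ s, ∑ a : N, ∑ b : N, genU A a b (F.u s) * genU A a b (F.u s) =
      (2 : ℝ) • casimirU F + ∑ s, ∑ a : N, ∑ b : N,
        (genU A a b (F.u s) - F.ε s • genU A b a (F.u s)) *
          (genU A a b (F.u s) - F.ε s • genU A b a (F.u s)) := by
  rw [casimirU, Finset.smul_sum, Finset.smul_sum, ← Finset.sum_add_distrib]
  refine Finset.sum_congr rfl fun s _ ↦ ?_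
  set G : N → N → glU A N := fun a b ↦ genU A a b (F.u s) with hG
  set e := F.ε s with he
  have hee : e * e = 1 := F.ε_sq s
  -- reindexed sums
  have r1 : ∑ a, ∑ b, G b a * G b a = ∑ a, ∑ b, G a b * G a b := Finset.sum_comm
  have r2 : ∑ a, ∑ b, G b a * G a b = ∑ a, ∑ b, G a b * G b a := Finset.sum_comm
  have expand : ∀ a b, (G a b - e • G b a) * (G a b - e • G b a) =
      G a b * G a b - e • (G a b * G b a) - e • (G b a * G a b) + (e * e) • (G b a * G b a) := by
    intro a b
    rw [mul_smul, sub_mul, mul_sub, mul_sub, smul_mul_assoc, mul_smul_comm, smul_mul_assoc,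
      mul_smul_comm]
    abel
  change (2 : ℝ) • ∑ a, ∑ b, G a b * G a b =
    (2 : ℝ) • (e • ∑ a, ∑ b, G a b * G b a) + ∑ a, ∑ b, (G a b - e • G b a) * (G a b - e • G b a)
  have hsum : ∑ a, ∑ b, (G a b - e • G b a) * (G a b - e • G b a) =
      ∑ a, ∑ b, G a b * G a b - e • ∑ a, ∑ b, G a b * G b a
        - e • ∑ a, ∑ b, G b a * G a b + (e * e) • ∑ a, ∑ b, G b a * G b a := by
    simp only [expand, Finset.sum_add_distrib, Finset.sum_sub_distrib, ← Finset.smul_sum]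
  rw [hsum, r1, r2, hee, one_smul, two_smul, two_smul]
  abel

/-- **Nelson's sum of squares versus the Casimir.** In `U(𝔤𝔩(N, A))`,
`2 ∑_{s,a,b} ι(X_{s,a,b})² = 2 Ω + ∑_{s,a,b} ι(Y_{s,a,b})²`: the Laplacian of the spanning family
`X_{s,a,b}` is the Casimir plus half a sum of squares of elements of `𝔨`
(per `s`: `∑_{ab} (X_{ab} - ε X_{ba})² = 2 ∑ X_{ab}² - 2 ε ∑ X_{ab} X_{ba}`, reindexing `(a,b) ↔ (b,a)`).
Harish-Chandra 1953, §11; Nelson 1959, §8 (`Δ = Ω + 2Ω_K`-type decompositions). [folklore] -/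
theorem two_smul_sum_sq_eq (F : SelfDualUnits A S) :
    (2 : ℝ) • ∑ p : S × N × N, ι ℝ (unitGen F p) * ι ℝ (unitGen F p) =
      (2 : ℝ) • casimirU F + ∑ p : S × N × N, ι ℝ (kGen F p) * ι ℝ (kGen F p) := by
  have h1 : ∑ p : S × N × N, ι ℝ (unitGen F p) * ι ℝ (unitGen F p) =
      ∑ s, ∑ a : N, ∑ b : N, genU A a b (F.u s) * genU A a b (F.u s) := by
    simp only [Fintype.sum_prod_type, unitGen, genU_apply]
  have h2 : ∑ p : S × N × N, ι ℝ (kGen F p) * ι ℝ (kGen F p) =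
      ∑ s, ∑ a : N, ∑ b : N, (genU A a b (F.u s) - F.ε s • genU A b a (F.u s)) *
        (genU A a b (F.u s) - F.ε s • genU A b a (F.u s)) := by
    simp only [Fintype.sum_prod_type, ι_kGen]
  rw [h1, h2]
  exact two_smul_sum_sq_genU_eq F

end Literature.NumberTheory.Automorphic
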